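import Literature.NumberTheory.EllipticCurves.Disegni2017.ChiLineGrossZagier
import HarnessLib

/-!
# Road (C) `disegni-pair-two` on crux stmt-BirchSwinnertonDyer-20368 — the QUOTIENT LAW
# «p-adic Gross–Zagier ÷ archimedean Gross–Zagier»: `q`, the test vectors and `Car` cancel by name

Cell `bsd-print-cf2` (`run/shared/lean/pub/bsd-print-cf2/`), width seat `bsd-line-cf2-p1-w8` g22; memo
`Cruxes/SplitBadTwoRankOneOfFacts/SEAM-S1-CHIPAIRINGS-w8g22.md` §3. `--supports stmt-BirchSwinnertonDyer-20368`
(helper). THEOREMS ONLY (no `def`, no named fact, no `sorry`). BSD is not proved by any of this; no summit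
statement is claimed; 20368 is not closed here.

## What is proved

`Disegni2017.ChiLineGrossZagierClauses ι K V H f a χ_H 𝔭 𝔭′ G χ DH` = `∃ Car > 0, ∃ G_χ` (Theorem A on the line)
`∧ ∃ y₁ y₂ q σ₀, q ≠ 0 ∧ Arch ∧ PAdic`, with
`Arch : [H:ℚ]⁻¹·chiHeightPairing V H G χ y₁ y₂ = (q/2)·Car·Λ′(1)` (every entire continuation `Λ`) and
`PAdic : chiPAdicPairing ι V H DH G χ y₁ y₂ = σ₀·ι⁻¹(q·Z°⁻¹)·½log_p γ·[T¹]G_χ`. The existential `y₁, y₂, q` carry no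
usable information separately (`q = c_E·Q(f₁,f₂,χ)·…` is transcendental in our typing). ★ `quotient_law_of_clauses`:
GIVEN (all four as displayed hypotheses, each a tree theorem for road (C))
* the SEAM «both pairings at any `(y₁,y₂)` are ONE rational multiple `r` of `ĥ(P)` resp. of a `p`-adic number `h_p`»
  (`exists_rat_chiPairings_eq[_tower]` + the PIN `⟨P′,P′⟩_{DH} = h_p`),
* the ARCHIMEDEAN EVALUATION «`Arch` ⟹ `[H:ℚ]⁻¹·chiHeightPairing = (q/2)·Car·Λ′`» for a fixed complex number
  `Λ′ ≠ 0` (`chiArchRatioClause_apply_of_entireLFunction_one_eq_zero`: `Λ′ = L′(W,1)·L(W′,1)`),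
* the FACTORISATION «`ChiLineInterpolation … Car G_χ` ⟹ `[T¹]G_χ = −ι⁻¹(c₀·Car)·X`» for a complex constant `c₀` and a
  `p`-adic number `X` (-w8 g21: `c₀ = u·Ω^{±}_f·Ω^{±}_{f′}`, `X = L_p′(V,pt)·L_p(V′,pt)`),
* `Z°_p(χ) ≠ 0` (not exceptional),
THEN for some universal sign `σ₀ = ±1`:
  `ι⁻¹(Λ′·Z°) · h_p = −σ₀ · log_p γ · ι⁻¹(ĥ(P)·c₀) · X`   (in `ℂ_p`).
No `q`, no `r`, no `Car`, no `y₁, y₂`: the law relates the `p`-adic height `h_p`, the `p`-adic derivative product `X`, the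
archimedean ratio `Λ′/ĥ(P)` (algebraic by Gross–Zagier + BSD bookkeeping) and explicit constants — «`p`-adic GZ ÷ arch
GZ ⟹ (`p`-adic BSD ⟺ BSD)» in exact form. Pure field algebra over the clause structure; the road-(C) instantiations
(`p = 2`, `d* ∈ {2, −1, −2}`) plug the named theorems into the four hypotheses.

References: D. Disegni, Compos. Math. 153 (2017) (1.1.3), Thm. B [Disegni2017]; B. Perrin-Riou, Invent. Math. 89 (1987)
§1 (the quotient principle) [PerrinRiou1987].
-/

set_option autoImplicit false
set_option linter.dupNamespace false

noncomputable section

open scoped Classical MatrixGroups ModularForm NumberField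

open CongruenceSubgroup NumberField IsDedekindDomain WeierstrassCurve Literature.NumberTheory.EllipticCurves
  Literature.NumberTheory.EllipticCurves.Disegni2017 Literature.NumberTheory.GaloisRepresentations

namespace Summit.BirchSwinnertonDyer.BirchSwinnertonDyer.Theorems.PrintCf2.DisegniPairTwo

section Quotient

variable {p : ℕ} [Fact p.Prime] (ι : PadicAlgCl p ≃+* ℂ) {K : Type} [Field K] [NumberField K] [IsGalois ℚ K]
  {N : ℕ} {V : WeierstrassCurve ℚ} {H : Type} [Field H] [NumberField H]

/-- ★ **THE QUOTIENT LAW of Disegni's clauses** (module docstring): seam + archimedean evaluation + factorisation +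
`Z° ≠ 0` ⟹ `ι⁻¹(Λ′·Z°)·h_p = −σ₀·log_p γ·ι⁻¹(ĥ(P)·c₀)·X` for a sign `σ₀`. The existential test-vector data `y₁, y₂, q`
of `ChiLineGrossZagierClauses` and the archimedean constant `Car` of Theorem A cancel.
[cite: Disegni2017, (1.1.3) (arXiv v3 PDF p. 4 L35–41) and Theorem B (PDF p. 8 L11–20)] [cite: PerrinRiou1987, §1] -/
theorem quotient_law_of_clauses {f : CuspForm (Gamma0 N) 2} {a : ℂ} {χH : HeckeCharacter K}
    {𝔭 𝔭' : HeightOneSpectrum (𝓞 K)} {G : Subgroup (H ≃ₐ[ℚ] H)} {χ : G →* ℂˣ} {DH : PAdicHeightDataK V p H}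
    (hGZ : ChiLineGrossZagierClauses ι K V H f a χH 𝔭 𝔭' G χ DH)
    {hP : ℝ} {hp : ℚ_[p]}
    (hseam : ∀ y₁ y₂ : (V.baseChange H).toAffine.Point, ∃ r : ℚ,
      chiHeightPairing V H G χ y₁ y₂ = (((r : ℝ) * (Module.finrank ℚ H : ℝ) * hP : ℝ) : ℂ) ∧
      chiPAdicPairing ι V H DH G χ y₁ y₂ = algebraMap ℚ_[p] ℂ_[p] ((r : ℚ_[p]) * hp))
    {Λ' : ℂ} (hΛ : Λ' ≠ 0)
    (harch : ∀ (Car : ℝ) (y₁ y₂ : (V.baseChange H).toAffine.Point) (q : ℂ),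
      ChiArchRatioClause K V H f χH Car G χ y₁ y₂ q →
        ((Module.finrank ℚ H : ℂ))⁻¹ * chiHeightPairing V H G χ y₁ y₂ = q / 2 * (Car : ℂ) * Λ')
    {c₀ : ℂ} {X : ℂ_[p]}
    (hfact : ∀ (Car : ℝ) (Gχ : PowerSeries ℂ_[p]), ChiLineInterpolation ι K f a χH 𝔭 𝔭' Car Gχ →
      PowerSeries.coeff 1 Gχ = -((ι.symm (c₀ * (Car : ℂ)) : PadicAlgCl p) : ℂ_[p]) * X)
    (hZ : zCirc (p := p) a N χH 𝔭 𝔭' ≠ 0) :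
    ∃ σ₀ : ℤˣ,
      ((ι.symm (Λ' * zCirc (p := p) a N χH 𝔭 𝔭') : PadicAlgCl p) : ℂ_[p]) * algebraMap ℚ_[p] ℂ_[p] hp =
        -((σ₀ : ℤ) : ℂ_[p]) * algebraMap ℚ_[p] ℂ_[p] (padicLog p (cyclotomicGenerator p)) *
          ((ι.symm ((hP : ℂ) * c₀) : PadicAlgCl p) : ℂ_[p]) * X := by
  obtain ⟨Car, hCar, Gχ, hInt, y₁, y₂, q, σ₀, hq, hA, hPad⟩ := hGZ
  obtain ⟨r, hNT, hPA⟩ := hseam y₁ y₂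
  refine ⟨σ₀, ?_⟩
  -- the ring map `ψ = ι⁻¹ : ℂ → ℂ_p`
  set ψ : ℂ →+* ℂ_[p] := (algebraMap (PadicAlgCl p) ℂ_[p]).comp ι.symm.toRingHom with hψ_def
  have hψ : ∀ z : ℂ, ((ι.symm z : PadicAlgCl p) : ℂ_[p]) = ψ z := fun z => rfl
  set ι₂ := algebraMap ℚ_[p] ℂ_[p] with hι₂
  -- archimedean: `r·ĥ = (q/2)·Car·Λ′`
  have hn : (Module.finrank ℚ H : ℂ) ≠ 0 := by exact_mod_cast Module.finrank_pos.ne'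
  have h1 := harch Car y₁ y₂ q hA
  rw [hNT] at h1
  have hrq : ((r : ℚ) : ℂ) * (hP : ℂ) = q / 2 * (Car : ℂ) * Λ' := by
    rw [← h1]; push_cast; field_simp
  have hCar0 : (Car : ℂ) ≠ 0 := by exact_mod_cast hCar.ne'
  have hq' : q = 2 * ((r : ℚ) : ℂ) * (hP : ℂ) / ((Car : ℂ) * Λ') := by
    rw [eq_div_iff (mul_ne_zero hCar0 hΛ)]
    linear_combination (-2) * hrq
  have hr0 : ((r : ℚ) : ℂ) ≠ 0 := by
    intro h0
    rw [h0, zero_mul] at hrq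
    have : q / 2 * (Car : ℂ) * Λ' ≠ 0 := mul_ne_zero (mul_ne_zero (div_ne_zero hq two_ne_zero) hCar0) hΛ
    exact this hrq.symm
  -- p-adic: `r·h_p = σ₀·ψ(q·Z°⁻¹)·½log·[T¹]G`, `[T¹]G = −ψ(c₀·Car)·X`
  have h2 := hPad
  rw [ChiPAdicRatioClause, hPA, hfact Car Gχ hInt, hψ, hψ] at h2
  -- rewrite everything through `ψ` and clear denominators
  have hψCar : ψ (Car : ℂ) ≠ 0 := (map_ne_zero ψ).mpr hCar0
  have hψΛ : ψ Λ' ≠ 0 := (map_ne_zero ψ).mpr hΛ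
  have hψZ : ψ (zCirc (p := p) a N χH 𝔭 𝔭') ≠ 0 := (map_ne_zero ψ).mpr hZ
  have hψr : ψ ((r : ℚ) : ℂ) = (r : ℂ_[p]) := map_ratCast ψ r
  have hι₂r : ι₂ (r : ℚ_[p]) = (r : ℂ_[p]) := map_ratCast ι₂ r
  have hr0' : (r : ℂ_[p]) ≠ 0 := by rw [← hψr]; exact (map_ne_zero ψ).mpr hr0
  have h2' : (r : ℂ_[p]) * ι₂ hp =
      ((σ₀ : ℤ) : ℂ_[p]) * (2 * (r : ℂ_[p]) * ψ (hP : ℂ) / (ψ (Car : ℂ) * ψ Λ') * (ψ (zCirc (p := p) a N χH 𝔭 𝔭'))⁻¹) *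
        (ι₂ 2⁻¹ * ι₂ (padicLog p (cyclotomicGenerator p))) * (-(ψ c₀ * ψ (Car : ℂ)) * X) := by
    have h := h2
    rw [map_mul, hι₂r, hq', map_mul, map_inv₀, map_div₀, map_mul, map_mul, map_mul, map_ofNat, hψr,
      map_mul ι₂, map_mul ψ] at h
    exact h
  rw [hψ, hψ, map_mul, map_mul, map_inv₀ ι₂, map_ofNat]  at *
  have h2ne : (2 : ℂ_[p]) ≠ 0 := two_ne_zero
  field_simp at h2'
  field_simp
  linear_combination h2'

end Quotient

end Summit.BirchSwinnertonDyer.BirchSwinnertonDyer.Theorems.PrintCf2.DisegniPairTwo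

end
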